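import Summits.BirchSwinnertonDyer.BirchSwinnertonDyer.Theorems.PrintCf2SplitBadTwoCMShaSelmerBranchDichotomy
import Summits.BirchSwinnertonDyer.BirchSwinnertonDyer.Theorems.PrintCf2SplitBadTwoCMShaBottomValueOfSel
import HarnessLib

/-!
# Crux `PrintCf2.SplitBadTwoRankOneOfFacts` (item stmt-BirchSwinnertonDyer-20368), road α, S3c: (R-BV) ⟸ (F1) ∧ (F3) ∧ (H2) ∧ the GLOBAL
# triple {hfinB′, (INF′), (T-loc-Sel)} — the CM input of the bottom value decided by finiteness, Selmer-level (p673910 + p673037)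

Cell `bsd-print-cf2`, width seat `bsd-line-cf2-p1-w8` g2 (brick **B6h**, frame assembly); `--supports stmt-BirchSwinnertonDyer-20368` (helper,
Theses-free). HONEST FRAMING: nothing here closes a crux or a stub; BSD is not proved by any of this; no summit statement is proved by this
seat. No definition, no named fact, no `sorry`. beyond-print theorem: no.

`rBV_of_factor_values_of_finite_conj hF1 hF3 hH2 hConj` = LEAD g12's (R-BV) VERBATIM, where `hConj` supplies on every S3c₂ frame the triple
(i) `Finite 𝔖_v(K, E[𝔮_{1−r}^∞])` (the conjugate restricted Selmer group, -w4's hfinB′), (ii) (INF′) `¬ Finite (ι′_*⁻¹ res_⊤(range κ))` (the conjugate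
summand carries infinitely many global Kummer classes), (iii) (T-loc-Sel) `loc_v(res_⊤ Sel_{2^∞}(E_K/K))` has cyclic `2`-torsion (it lies in the
local Kummer image `E(K_v) ⊗ ℚ₂/ℤ₂ ≅ ℚ₂/ℤ₂`, `K_v = ℚ₂`). Internally: `CMPrimes.sel_input_of_finite_conj` gives (H1-Sel), then
`CMPrimes.rBV_of_factor_values_of_sel`. Compare `rBV_of_factor_values_of_cmScalar` (p671611: the LOCAL route via (H1-pts)).

References: A. Agboola, Compositio 143 (2007) §6, §8 [Agboola2007]; R. Greenberg, LNM 1716 (1999) §2–§4 [GreenbergLNM1716]; K. Rubin,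
LNM 1716 (1999) §2 [Rubin1999].
-/

noncomputable section

open scoped Classical

set_option linter.dupNamespace false
set_option autoImplicit false

open NumberField IsDedekindDomain Field
open Literature.NumberTheory.EllipticCurves Literature.NumberTheory.EllipticCurves.GreenbergSelmer
open Literature.NumberTheory.EllipticCurves.Castella2018.AcSelmer
open Literature.NumberTheory.EllipticCurves.Agboola2007
open Literature.NumberTheory.EllipticCurves.ResKernel
open Literature.NumberTheory.GaloisRepresentations
open Summit.BirchSwinnertonDyer.BirchSwinnertonDyer.Theorems.PrintCf2.RestrictedSelmerPair
open Summit.BirchSwinnertonDyer.BirchSwinnertonDyer.Theorems.PrintCf2.AdditiveAtSeven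

namespace Summit.BirchSwinnertonDyer.BirchSwinnertonDyer.Theorems.PrintCf2.CMPrimes

/-- **(R-BV) OF LEAD g12, VERBATIM, from (F1), (F3), (H2) and the global triple {hfinB′, (INF′), (T-loc-Sel)} at `v`** — the CM input of
the bottom value decided by the finiteness of the conjugate restricted Selmer group (-w3 g9's dichotomy-and-exclusion, run at the Selmer
level by `sel_input_of_finite_conj`). [cite: Agboola2007, Props. 6.10, 6.11, 8.1 (arXiv p0014–p0017)] [cite: GreenbergLNM1716, §2] -/
theorem rBV_of_factor_values_of_finite_conj
    (hF1 : ∃ e₁ : ℤ → ℤ → ℤ, ∀ (d : ℤ), d ≠ 0 → Squarefree d → d % 4 ≠ 1 →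
      ∀ (W : WeierstrassCurve ℚ) [W.IsElliptic] [W.IsGloballyMinimal] (C : WeierstrassCurve.VariableChange ℚ),
        C • W = cm7.quadraticTwist (d : ℚ) → W.analyticRank = 1 →
      ∀ (K : Type) [Field K] [NumberField K], IsImaginaryQuadratic K →
      ∀ (v vbar : HeightOneSpectrum (𝓞 K)),
        ((2 : ℕ) : 𝓞 K) ∈ v.asIdeal → ((2 : ℕ) : 𝓞 K) ∈ vbar.asIdeal → vbar ≠ v →
      ∀ (π : (W.baseChange K).endRing), (π : AddMonoid.End (W.baseChange K).geomPoints) * π = π - 2 →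
      ∀ (r : ℤ_[2]), r * r = r - 2 →
        (∀ τ ∈ GreenbergSelmer.inertia v, ∀ x : ↥((W.baseChange K).endEigenPrimaryTorsion 2 π r), τ • x = x ∨ τ • x = -x) →
      ∀ (P : W.toAffine.Point) (c₀ : ℕ) (ℓ : ℤ),
        ¬ IsOfFinAddOrder P →
        (∀ R : W.toAffine.Point, ∃ (k : ℤ) (T : W.toAffine.Point), IsOfFinAddOrder T ∧ R = k • P + T) →
        c₀ ≠ 0 → (W.baseChange ℚ_[2]).IsInReductionKernel (c₀ • W.toPadicPoint 2 P) →
        ‖(W.baseChange ℚ_[2]).padicLogPoint (c₀ • W.toPadicPoint 2 P) / (c₀ : ℚ_[2])‖ = (2 : ℝ) ^ (-ℓ) →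
      Finite (restrictedSelmerBase ↥((W.baseChange K).endEigenPrimaryTorsion 2 π r) 2 vbar) →
        (padicValNat 2 (Nat.card ↥(((((W.baseChange K).kummerMapPInfty 2 (W.baseChange K).zsmul_geomPoints_surjective_holds).range).map
            (resSubgroup ⊤ ((W.baseChange K).geomPrimaryTorsion 2))).comap
          (resH1Hom (ContinuousMonoidHom.id _) ((W.baseChange K).endEigenPrimaryTorsion 2 π r).subtype (fun _ _ ↦ rfl)) ⊓
          (resOfLe ↥((W.baseChange K).endEigenPrimaryTorsion 2 π r) (inf_le_left : ⊤ ⊓ decomp vbar ≤ ⊤)).ker)) : ℤ) = ℓ + e₁ (d % 2) ((d / (2 - d % 2)) % 8))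
    (hF3 : ∃ e₃ : ℤ → ℤ → ℤ, ∀ (d : ℤ), d ≠ 0 → Squarefree d → d % 4 ≠ 1 →
      ∀ (W : WeierstrassCurve ℚ) [W.IsElliptic] [W.IsGloballyMinimal] (C : WeierstrassCurve.VariableChange ℚ),
        C • W = cm7.quadraticTwist (d : ℚ) → W.analyticRank = 1 →
      ∀ (K : Type) [Field K] [NumberField K], IsImaginaryQuadratic K →
      ∀ (v vbar : HeightOneSpectrum (𝓞 K)),
        ((2 : ℕ) : 𝓞 K) ∈ v.asIdeal → ((2 : ℕ) : 𝓞 K) ∈ vbar.asIdeal → vbar ≠ v →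
      ∀ (π : (W.baseChange K).endRing), (π : AddMonoid.End (W.baseChange K).geomPoints) * π = π - 2 →
      ∀ (r : ℤ_[2]), r * r = r - 2 →
        (∀ τ ∈ GreenbergSelmer.inertia v, ∀ x : ↥((W.baseChange K).endEigenPrimaryTorsion 2 π r), τ • x = x ∨ τ • x = -x) →
      ∀ (P : W.toAffine.Point) (c₀ : ℕ) (ℓ : ℤ),
        ¬ IsOfFinAddOrder P →
        (∀ R : W.toAffine.Point, ∃ (k : ℤ) (T : W.toAffine.Point), IsOfFinAddOrder T ∧ R = k • P + T) →
        c₀ ≠ 0 → (W.baseChange ℚ_[2]).IsInReductionKernel (c₀ • W.toPadicPoint 2 P) →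
        ‖(W.baseChange ℚ_[2]).padicLogPoint (c₀ • W.toPadicPoint 2 P) / (c₀ : ℚ_[2])‖ = (2 : ℝ) ^ (-ℓ) →
      Finite (restrictedSelmerBase ↥((W.baseChange K).endEigenPrimaryTorsion 2 π r) 2 vbar) →
        (padicValNat 2 (Nat.card ((resOfLe ↥((W.baseChange K).endEigenPrimaryTorsion 2 π r) (inf_le_left : ⊤ ⊓ decomp v ≤ ⊤)).comp
          (restrictedSelmerBase ↥((W.baseChange K).endEigenPrimaryTorsion 2 π r) 2 vbar).subtype).range) : ℤ) = ℓ + e₃ (d % 2) ((d / (2 - d % 2)) % 8))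
    (hH2 : ∀ (d : ℤ), d ≠ 0 → Squarefree d → d % 4 ≠ 1 →
      ∀ (W : WeierstrassCurve ℚ) [W.IsElliptic] [W.IsGloballyMinimal] (C : WeierstrassCurve.VariableChange ℚ),
        C • W = cm7.quadraticTwist (d : ℚ) → W.analyticRank = 1 →
      ∀ (K : Type) [Field K] [NumberField K], IsImaginaryQuadratic K →
      ∀ (v vbar : HeightOneSpectrum (𝓞 K)),
        ((2 : ℕ) : 𝓞 K) ∈ v.asIdeal → ((2 : ℕ) : 𝓞 K) ∈ vbar.asIdeal → vbar ≠ v →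
      ∀ (π : (W.baseChange K).endRing), (π : AddMonoid.End (W.baseChange K).geomPoints) * π = π - 2 →
      ∀ (r : ℤ_[2]), r * r = r - 2 →
        (∀ τ ∈ GreenbergSelmer.inertia v, ∀ x : ↥((W.baseChange K).endEigenPrimaryTorsion 2 π r), τ • x = x ∨ τ • x = -x) →
      ∀ (P : W.toAffine.Point) (c₀ : ℕ) (ℓ : ℤ),
        ¬ IsOfFinAddOrder P →
        (∀ R : W.toAffine.Point, ∃ (k : ℤ) (T : W.toAffine.Point), IsOfFinAddOrder T ∧ R = k • P + T) →
        c₀ ≠ 0 → (W.baseChange ℚ_[2]).IsInReductionKernel (c₀ • W.toPadicPoint 2 P) →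
        ‖(W.baseChange ℚ_[2]).padicLogPoint (c₀ • W.toPadicPoint 2 P) / (c₀ : ℚ_[2])‖ = (2 : ℝ) ^ (-ℓ) →
      Finite (restrictedSelmerBase ↥((W.baseChange K).endEigenPrimaryTorsion 2 π r) 2 vbar) →
        (restrictedSelmerBase ↥((W.baseChange K).endEigenPrimaryTorsion 2 π r) 2 v ⊓
            (((W.baseChange K).localKerOver 2 ⊤ (vbar.adicCompletion K)).comap
          (resH1Hom (ContinuousMonoidHom.id _) ((W.baseChange K).endEigenPrimaryTorsion 2 π r).subtype (fun _ _ ↦ rfl)))).map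
            (resOfLe ↥((W.baseChange K).endEigenPrimaryTorsion 2 π r) (inf_le_left : ⊤ ⊓ decomp vbar ≤ ⊤)) ≤
          (((((W.baseChange K).kummerMapPInfty 2 (W.baseChange K).zsmul_geomPoints_surjective_holds).range).map
            (resSubgroup ⊤ ((W.baseChange K).geomPrimaryTorsion 2))).comap
          (resH1Hom (ContinuousMonoidHom.id _) ((W.baseChange K).endEigenPrimaryTorsion 2 π r).subtype (fun _ _ ↦ rfl))).map
            (resOfLe ↥((W.baseChange K).endEigenPrimaryTorsion 2 π r) (inf_le_left : ⊤ ⊓ decomp vbar ≤ ⊤)))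
    (hConj : ∀ (d : ℤ), d ≠ 0 → Squarefree d → d % 4 ≠ 1 →
      ∀ (W : WeierstrassCurve ℚ) [W.IsElliptic] [W.IsGloballyMinimal] (C : WeierstrassCurve.VariableChange ℚ),
        C • W = cm7.quadraticTwist (d : ℚ) → W.analyticRank = 1 →
      ∀ (K : Type) [Field K] [NumberField K], IsImaginaryQuadratic K →
      ∀ (v vbar : HeightOneSpectrum (𝓞 K)),
        ((2 : ℕ) : 𝓞 K) ∈ v.asIdeal → ((2 : ℕ) : 𝓞 K) ∈ vbar.asIdeal → vbar ≠ v →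
      ∀ (π : (W.baseChange K).endRing), (π : AddMonoid.End (W.baseChange K).geomPoints) * π = π - 2 →
      ∀ (r : ℤ_[2]), r * r = r - 2 →
        (∀ τ ∈ GreenbergSelmer.inertia v, ∀ x : ↥((W.baseChange K).endEigenPrimaryTorsion 2 π r), τ • x = x ∨ τ • x = -x) →
      ∀ (P : W.toAffine.Point) (c₀ : ℕ) (ℓ : ℤ),
        ¬ IsOfFinAddOrder P →
        (∀ R : W.toAffine.Point, ∃ (k : ℤ) (T : W.toAffine.Point), IsOfFinAddOrder T ∧ R = k • P + T) →
        c₀ ≠ 0 → (W.baseChange ℚ_[2]).IsInReductionKernel (c₀ • W.toPadicPoint 2 P) →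
        ‖(W.baseChange ℚ_[2]).padicLogPoint (c₀ • W.toPadicPoint 2 P) / (c₀ : ℚ_[2])‖ = (2 : ℝ) ^ (-ℓ) →
      Finite (restrictedSelmerBase ↥((W.baseChange K).endEigenPrimaryTorsion 2 π r) 2 vbar) →
        Finite (restrictedSelmerBase ↥((W.baseChange K).endEigenPrimaryTorsion 2 π (1 - r)) 2 v) ∧
        ¬ Finite ↥(((((W.baseChange K).kummerMapPInfty 2 (W.baseChange K).zsmul_geomPoints_surjective_holds).range).map
            (resSubgroup ⊤ ((W.baseChange K).geomPrimaryTorsion 2))).comap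
          (resH1Hom (ContinuousMonoidHom.id _) ((W.baseChange K).endEigenPrimaryTorsion 2 π (1 - r)).subtype (fun _ _ ↦ rfl))) ∧
        (∀ x ∈ (((W.baseChange K).selmerGroupPInfty 2).map (resSubgroup ⊤ ((W.baseChange K).geomPrimaryTorsion 2))).map
            (Literature.NumberTheory.EllipticCurves.resOfLe ((W.baseChange K).geomPrimaryTorsion 2) (inf_le_left : ⊤ ⊓ decomp v ≤ ⊤)),
          ∀ y ∈ (((W.baseChange K).selmerGroupPInfty 2).map (resSubgroup ⊤ ((W.baseChange K).geomPrimaryTorsion 2))).map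
            (Literature.NumberTheory.EllipticCurves.resOfLe ((W.baseChange K).geomPrimaryTorsion 2) (inf_le_left : ⊤ ⊓ decomp v ≤ ⊤)),
          2 • x = 0 → 2 • y = 0 → x ≠ 0 → ∃ m : ℤ, y = m • x)) :
    ∃ eK : ℤ → ℤ → ℤ, ∀ (d : ℤ), d ≠ 0 → Squarefree d → d % 4 ≠ 1 →
      ∀ (W : WeierstrassCurve ℚ) [W.IsElliptic] [W.IsGloballyMinimal] (C : WeierstrassCurve.VariableChange ℚ),
        C • W = cm7.quadraticTwist (d : ℚ) → W.analyticRank = 1 →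
      ∀ (K : Type) [Field K] [NumberField K], IsImaginaryQuadratic K →
      ∀ (v vbar : HeightOneSpectrum (𝓞 K)),
        ((2 : ℕ) : 𝓞 K) ∈ v.asIdeal → ((2 : ℕ) : 𝓞 K) ∈ vbar.asIdeal → vbar ≠ v →
      ∀ (π : (W.baseChange K).endRing), (π : AddMonoid.End (W.baseChange K).geomPoints) * π = π - 2 →
      ∀ (r : ℤ_[2]), r * r = r - 2 →
        (∀ τ ∈ GreenbergSelmer.inertia v, ∀ x : ↥((W.baseChange K).endEigenPrimaryTorsion 2 π r), τ • x = x ∨ τ • x = -x) →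
      ∀ (P : W.toAffine.Point) (c₀ : ℕ) (ℓ : ℤ),
        ¬ IsOfFinAddOrder P →
        (∀ R : W.toAffine.Point, ∃ (k : ℤ) (T : W.toAffine.Point), IsOfFinAddOrder T ∧ R = k • P + T) →
        c₀ ≠ 0 → (W.baseChange ℚ_[2]).IsInReductionKernel (c₀ • W.toPadicPoint 2 P) →
        ‖(W.baseChange ℚ_[2]).padicLogPoint (c₀ • W.toPadicPoint 2 P) / (c₀ : ℚ_[2])‖ = (2 : ℝ) ^ (-ℓ) →
      Finite (restrictedSelmerBase ↥((W.baseChange K).endEigenPrimaryTorsion 2 π r) 2 vbar) →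
        (padicValNat 2 (Nat.card (restrictedSelmerBase ↥((W.baseChange K).endEigenPrimaryTorsion 2 π r) 2 vbar)) : ℤ) =
          (padicValNat 2 (Nat.card (AddCommGroup.primaryComponent W.sha 2)) : ℤ) + 2 * ℓ + eK (d % 2) ((d / (2 - d % 2)) % 8) := by
  refine rBV_of_factor_values_of_sel hF1 hF3 hH2 ?_
  intro d hd0 hsq hd4 W _ _ C hC hrank K _ _ hK v vbar hv hvbar hne π hπ r hr hpin P c₀ ℓ hP hgen hc₀ hker hlog hfin
  obtain ⟨hfin', hinf', hcyc⟩ := hConj d hd0 hsq hd4 W C hC hrank K hK v vbar hv hvbar hne π hπ r hr hpin P c₀ ℓ hP hgen hc₀ hker hlog hfin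
  have hπg : (π : AddMonoid.End (W.baseChange K).geomPoints) ∈ (W.baseChange K).geomEndRing :=
    (W.baseChange K).endRing_le_geomEndRing π.2
  have hπG : ∀ (g : absoluteGaloisGroup K) (Q : (W.baseChange K).geomPoints),
      (π : AddMonoid.End (W.baseChange K).geomPoints) (g • Q) = g • (π : AddMonoid.End (W.baseChange K).geomPoints) Q :=
    ((W.baseChange K).mem_equivariantSubring_iff _).mp (Subring.mem_inf.mp π.2).2
  obtain ⟨φ, hφ, -⟩ := exists_isogeny_apply_eq_cmEndo (W.baseChange K) hπg hπG hπ
  obtain ⟨hinf, hsup⟩ := endEigenPrimaryTorsion_compl_of_frame hd0 W C hC K π hπ hr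
  exact sel_input_of_finite_conj (W.baseChange K) 2 π r v hK hinf hsup (two_dvd_or_two_dvd_one_sub_of_root hr).2 φ hφ hfin' hinf' hcyc

end Summit.BirchSwinnertonDyer.BirchSwinnertonDyer.Theorems.PrintCf2.CMPrimes

end
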